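import Mathlib

/-!
# Tier4/LitBMM — Bergeron–Millson–Moeglin, *The Hodge conjecture and arithmetic quotients of complex balls*,
Acta Math. 216 (2016) 1–125: Theorem 7.2, Corollary 7.3 and the §7.2 twist Remark, AS PRINTED

Blind re-derivation cell `pub-hodge-repro`, Tier 4 (README §9–§10), seat `t4-lit-2` (gen 0), family = the
identification cluster (STATUS S11855 / S11858 / S11865).  v2 (p658240 = v1, ACCEPTED commit edb4bc182c14) = v1 +
`BMMSpecialLiftSetting` / `BMM2016_Thm9_1` (the archimedean datum of the lifts named — t4-plan-3 S11908's ask); v3 (p658533 = v2,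
ACCEPTED commit aa1ea0fb322d) = v2 + the §3 Vogan–Zuckerman lowest K-types (`BMMKTypeSetting`, `vzWeight`, `BMM2016_Lemma3_7`,
`BMM2016_Lemma3_9`, `BMM2016_Lemma3_11` — t4-plan-4 S12222's WANTED row); every earlier declaration unchanged.  Target tree path
`lean/Summits/Ventures/HodgeRepro/Tier4/LitBMM.lean`.  Every `def … : Prop` below is a PRINTED statement typed with
its hypotheses explicit over a small interface (`BMMSetting`); NO published theorem is proved here (seat rule);
the theorems at the end are one-line compositions of the named Props.  Statement-exact quotes with page/line:
HOME/proofs/t4/inputs/t4-lit-2.md rows I-t4-lit-2-1 … -15 (the journal print, HOME/lit-deposits/BMM2016-acta216-print,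
sha256 b2e1c5aa12ec3b8e…; page layer lit/t3-lit-g3-extract/BMM2016-acta216-print/pdfNNN.txt, PDF page = printed page).

**What (P) consumes from BMM.**  route/TIER3.md §1 item 3 writes the witness forms as
`f^*Ω_s = θ(μ_0) ∧ θ(μ_1)`, `f^*Ω_{s̄} = θ(μ_2) ∧ θ(μ_3)`, «wedges of theta lifts of U(1)-characters (BMM Cor 65 / Liu
Prop 4.13, PRINTED)»; «BMM Cor 65» is the arXiv:1306.1515 numbering of the print's **Corollary 7.3** (ROUTE.md
§1 row S4ᶜ: «H^{1,0}, H^{0,1} spanned by theta lifts of characters of U(1)»).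

**Corollary 7.3 (p. 66 L11–L13, VERBATIM).** «Let S be any connected component of S(K) and let a and b be
integers such that 3(a+b)+|a−b| < 2m. Then H^{b×q,a×q}(S, ℂ) is generated by classes of theta lifts from unitary
groups of signature (a,b) at infinity.»

**Theorem 7.2 (p. 65 L48–L51, VERBATIM).** «Let a and b be integers such that 3(a+b)+|a−b| < 2m and let
π_f ∈ Coh_f^{b,a}. Set π = A(b×q,a×q) ⊗ π_f. Then π is in the image of the ψ-theta correspondence from a smaller
group U(W) of signature (a,b) at infinity.»  (p. 65 L46–L47: «The main automorphic ingredient of our paper is the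
following theorem. It is a corollary of Proposition 13.4 below whose proof is the goal of Part 3.»)

**The setting (§6.1 p. 54 L20–L39; §6.2 p. 55 L3–L13; §6.4 p. 57 L26–L37; §6.7 p. 60 L12–L14; §6.8 p. 60 L33–L42).**
«Let E be a CM-field with totally real maximal subfield F satisfying [F:ℚ] = d. We assume that d > 1. […]
Let (V, (·,·)) be a non-degenerate anisotropic Hermitian vector space over E with dim_E V = m. […] (p_j, q_j) is the
signature of V_{τ_j}. We will consider in this paper only those (V, (·,·)) such that q_2 = … = q_d = 0 and let
(p,q) = (p_1,q_1). By replacing (·,·) with −(·,·) we can, and will, assume that p ⩾ q.»  `G = Res_{F/ℚ} GU(V)`,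
`S(K) = G(ℚ)\(X × G(𝔸_f))/K` with `K` neat; «Given two integers a and b, we denote by H^{b×q,a×q}(S(K), ℂ) the
part of H^•(S(K), ℂ) which corresponds to the cohomological representation π_∞ = A(b×q,a×q)» (6.8); «We denote by
Coh_f^{b,a} the set of π_f such that Inf(π_f) contains A(b×q,a×q).»  Footnote (1) p. 4 L40–L41: «In the body of
the paper we will rather write b×q, a×q in order to write U(a,b) instead of U(b,a).»  For q = 1 (p. 3 L39–L40
«if q = 1 we have that SH^•(S, ℂ) = H^•(S, ℂ)») and degree a + b = 1 the refined type H^{b×1,a×1} is H^{b,a}.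

**The theta lift (§7.3 p. 64 L5–L23).** «For a π′ ∈ A_c(U(W)), the integral
θ^f_{ψ,χ,φ}(g) = ∫_{[U_n]} θ_{ψ,χ,φ}(g,g′) f(g′) dg′ (7.3), with f ∈ H_{π′} (the space of π′), defines an automorphic
function on U_m(𝔸) […] We denote by Θ^V_{ψ,χ,W}(π′) the space of the automorphic representation generated by all
θ^f_{ψ,χ,φ}(g) as φ and f vary, and call Θ^V_{ψ,χ,W}(π′) the (ψ,χ)-theta lifting of π′ to U_m(𝔸).»  A «theta lift»
of Corollary 7.3 is therefore a DATUM `(W, π′, χ, φ, f)` — here the type `LiftDatum` — and its class is the class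
in `H^•(S, ℂ)` of the form `θ^f_{ψ,χ,φ}`; for `dim W = 1`, `π′` is a character of `U(1)(𝔸)` trivial on `U(W)(F)`.

**The §7.2 Remark (p. 63 L33–p. 64 L4, VERBATIM).** «Let χ′ = (χ′_1, χ′_2) be another pair of characters of
𝔸_E^×/E^× whose restrictions to 𝔸^× satisfy χ′_1|_{𝔸^×} = ε^m_{E/F} and χ′_2|_{𝔸^×} = ε^n_{E/F}, and put
µ = χ′_1 χ_1^{−1} and ν = χ′_2 χ_2^{−1}. Since µ|_{𝔸^×} = ν|_{𝔸^×} = 1, we can define characters µ′ and ν′ of 𝔸^1_E —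
the adelic points of the kernel of the norm N_{E/F} — by setting µ′(x/x̄) = µ(x) and ν′(x/x̄) = ν(x). Let
µ_n = µ′∘det and ν_m = ν′∘det be the associated characters of U_n(𝔸) and U_m(𝔸), respectively. Then it follows
from the explicit formulas contained in [42] that ω_ψ(ĩ_{χ′}(g,g′)) = ω_ψ(ĩ_χ(g,g′)) ν_m(g) µ_n(g′).»

**Theorem 9.1 — the archimedean datum NAMED (§9.1–§9.2 p. 72 L17–L41, p. 73 L2–L3, VERBATIM; row I-t4-lit-2-20).**
«9.2. The special lift. It follows from Theorem 7.2 that if π_f ∈ Coh_f^{b,a} then π = A(b×q,a×q) ⊗ π_f is in the image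
of the ψ-theta correspondence from a smaller group U(W) of signature (a,b) at infinity. In particular the whole
cohomology group H^{b×q,a×q}(Sh(G), ℂ) is generated by the automorphic functions θ^f_{ψ,χ,φ} as in (7.3) where φ and f
vary. Here f is an automorphic function of GU(W) and φ is a Schwartz function in the space S(X(𝔸)) associated with a
choice of a complete (global) polarization of the symplectic space W. We may furthermore restrict to functions φ that
are decomposable as φ_∞ ⊗ φ_f. Now at infinity the Schwartz space S(X(F_∞)) is a model for the Weil representation. We
will abuse notation and denote by ϕ_{bq,aq} the Schwartz function in S(X(F_∞)) which is the tensor product of ϕ_{bq,aq}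
of §5, equation (5.11), at the infinite place where the real group is non-compact and Gaussians at the other infinite
places. We finally denote by H^{b×q,a×q}(Sh(G), ℂ)_{special} the subspace of special lifts that are generated by the
projections in H^{b×q,a×q}(Sh(G), ℂ) of the automorphic functions θ^f_{ψ,χ,ϕ_{bq,aq}⊗φ_f} as φ_f, χ and f vary.»
«Theorem 9.1. We have H^{b×q,a×q}(Sh(G), ℂ)_{special} = H^{b×q,a×q}(Sh(G), ℂ).»  (Sh(G) = lim_K S(K), §6.6 p. 59 L8–L12;
the Gaussian ϕ_0(x) = exp(−π trace(x,x)) of §8.7 p. 70 L15–L18 is «the unique element (up to scalar multiples) fixed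
by the compact group U(m)», p. 73 L45–L46.)  This is the form of «H^{1,0}(X) is spanned by theta lifts of characters
of U(1)» WITH the archimedean Schwartz datum of the lifts named — at q = 1, (b,a) = (1,0): ϕ_{1,0}, the holomorphic
(q,0)-cocycle ψ_{q,0} of Proposition 5.17 / Corollary 5.16 in the Schrödinger model (5.11), at the (2,1) place and the
Gaussian at the definite places (typed as `BMMSpecialLiftSetting` / `BMM2016_Thm9_1` below; the print does not choose
φ_f or the splitting pair χ).

**The lowest K-types (§3.2 p. 14 L17–L29; Lemma 3.7 + Remark p. 22 L2–L15; Lemma 3.9 + Remark p. 23 L4–L18; §3.13 + Lemma 3.11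
p. 23 L19–L24, p. 24 L11–L33; rows I-t4-lit-2-24 … -27).**  «Let e(q) be a generator of the line ⋀^R(u∩p); we shall refer to such a
vector as a Vogan–Zuckerman vector. Then e(q) is the highest weight vector of an irreducible representation V(q) of K
contained in ⋀^R p (and whose highest weight is thus necessarily 2ϱ(u∩p)). The representation A_q is then uniquely
characterized by the following two properties: (1) A_q is unitary with trivial central character and with the same
infinitesimal character as the trivial representation; (2) Hom_K(V(q), A_q) ≠ 0. […] Moreover, V(q) occurs with
multiplicity 1 in A_q and ⋀^R p.»  With `K_ℂ = GL(p) × GL(q)` and highest weights written `(p entries; q entries)`: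
Lemma 3.7, Remark: «V(b×q) ≅ S_{b×q}(ℂ^p) ⊗ (⋀^q(ℂ^q))^{−b} has highest weight (q, …, q [b], 0, …, 0 [p−b]; −b, …, −b [q])»;
Lemma 3.9, Remark: «S_{a×q}((ℂ^p)^*) ⊗ (⋀^q ℂ^q)^a has highest weight (0, …, 0 [p−a], −q, …, −q [a]; a, …, a [q])»;
§3.13 («Here we assume that a and b are positive integers satisfying a + b ⩽ p») and Lemma 3.11: «e(bq,aq) […] is the highest
weight vector of the irreducible K_ℂ-submodule V(b×q,a×q) ⊂ ⋀^{bq,aq} p, which is isomorphic to the Cartan product of the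
representations S_{b×q}(V_+) ⊗ (⋀^q(V_−^*))^b and S_{a×q}(V_+^*) ⊗ (⋀^q(V_−))^a», whose highest weight (p. 24 L19–L27) is
«(q, …, q [b], 0, …, 0, −q, …, −q [a]; a−b, …, a−b [q])».  At `U(2,1)`: `(a,b) = (1,1)` gives `(1, −1; 0)` — the lowest
`K`-type of the `(1,1)`-cohomological representation (t4-plan-4's mixed-plane line); `(0,1)` gives `(1, 0; −1)`, `(1,0)` gives
`(0, −1; 1)`.

**Built-in hypotheses / what is NOT typed.**  The interface carries `d > 1`, `m = p + q`, `p ≥ q` and the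
signature bookkeeping of the lift data as FIELDS; it does not construct `S(K)`, the Weil representation or the
cocycles — «class of a theta lift» and «H^{b×q,a×q}» are parameters (`cls`, `H`), exactly as strong as the listed
properties.  Theorem 6.1 / Corollary 6.2 (the polarised ℚ-sub-Hodge structures, rows I-t4-lit-2-6 and -7) and
Proposition 5.17 (the special cocycles, row -10) are NOT typed here (no line has named them).  SCOPE CAVEAT
(p. 62 L2–L7, row -9): for p = 2 — the 2-ball of (P) — BMM state that H^{1,1}(S(K), ℂ) is NOT generated by theta
lifts («This is no more true when p = 2»); Corollary 7.3 at m = 3 reaches only a + b ≤ 1, i.e. H^{1,0} and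
H^{0,1}; nothing here says anything about H^{1,1}.  Nothing here says anything about the status of the Hodge
conjecture for CM abelian varieties, which is NOT proved (HC_CM is NOT proved by anyone in this repository).
-/

set_option autoImplicit false

noncomputable section

namespace Summit.Ventures.HodgeRepro.Tier4.Lit

/-- **The setting of BMM Part 2 as an interface** (§6.1, §6.2, §6.4, §6.7, §6.8, §7.3 — quotes in the module
docstring): the numerical invariants `d = [F:ℚ] > 1`, `m = dim_E V = p + q`, `p ≥ q`; one connected component
`S` of `S(K)` (`K` neat) through its cohomology — the ℂ-module parameter `Coh = H^•(S, ℂ)` — with the refined pieces `H b a = H^{b×q,a×q}(S, ℂ)`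
(argument order `(b, a)` as printed); the theta-lift data `(W, π′, χ, φ, f)` of §7.3 as a type `LiftDatum` with
`dim_E W`, the signature of `W` at the distinguished infinite place and the class `cls D ∈ H^•(S, ℂ)` of the
automorphic form `θ^f_{ψ,χ,φ}`; and the finite parts `π_f` with the sets `Cohf b a = Coh_f^{b,a}` and the printed
predicate «A(b×q,a×q) ⊗ π_f is in the image of the ψ-theta correspondence from a smaller group U(W) of signature
(a,b) at infinity».  Every field is a parameter. -/
structure BMMSetting (Coh : Type) [AddCommGroup Coh] [Module ℂ Coh] where
  /-- `d = [F : ℚ]` for the totally real field `F = E⁺` -/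
  d : ℕ
  /-- BMM §6.1: «We assume that d > 1» -/
  d_gt_one : 1 < d
  /-- `m = dim_E V` (`V` anisotropic Hermitian over the CM field `E`) -/
  m : ℕ
  /-- the signature `(p, q)` of `V_{τ_1}`; `V_{τ_j}` is definite for `j ≥ 2` -/
  p : ℕ
  q : ℕ
  /-- `m = p + q` -/
  m_eq : m = p + q
  /-- BMM §6.1: «we can, and will, assume that p ⩾ q» -/
  q_le_p : q ≤ p
  /-- `H b a = H^{b×q,a×q}(S, ℂ)`, the part of `H^•(S, ℂ)` corresponding to `A(b×q,a×q)` (BMM (6.8)) -/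
  H : ℕ → ℕ → Submodule ℂ Coh
  /-- the theta-lift data `(W, π′, χ, φ, f)` of BMM §7.3 -/
  LiftDatum : Type
  /-- `dim_E W` of the datum's skew-Hermitian space -/
  dimW : LiftDatum → ℕ
  /-- the signature `(a, b)` of `W` «at infinity» (at the distinguished place `τ_1`) -/
  signature : LiftDatum → ℕ × ℕ
  /-- the signature sums to the dimension -/
  signature_sum : ∀ D : LiftDatum, (signature D).1 + (signature D).2 = dimW D
  /-- the class in `H^•(S, ℂ)` of the theta lift `θ^f_{ψ,χ,φ}` of the datum -/
  cls : LiftDatum → Coh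
  /-- the finite parts `π_f` of the automorphic representations of `G` (BMM §6.6) -/
  AutRepF : Type
  /-- `Cohf b a = Coh_f^{b,a}`: the `π_f` with `A(b×q,a×q) ∈ Inf(π_f)` (BMM §6.7) -/
  Cohf : ℕ → ℕ → Set AutRepF
  /-- the printed predicate of Theorem 7.2: `InThetaImage b a πf (a', b')` = «`A(b×q,a×q) ⊗ π_f` is in the image
  of the ψ-theta correspondence from a smaller group `U(W)` of signature `(a', b')` at infinity» (Definition 7.1
  extended to the similitude group as in §7.5) -/
  InThetaImage : ℕ → ℕ → AutRepF → ℕ × ℕ → Prop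

namespace BMMSetting

variable {Coh : Type} [AddCommGroup Coh] [Module ℂ Coh] (B : BMMSetting Coh)

/-- BMM's numerical hypothesis `3(a+b) + |a−b| < 2m` on a pair of integers `(a, b)` (with `a, b ≥ 0`). -/
def Hyp (a b : ℕ) : Prop := 3 * (a + b) + ((a : ℤ) - b).natAbs < 2 * B.m

/-- the classes of the theta lifts from unitary groups of signature `(a, b)` at infinity -/
def liftClasses (a b : ℕ) : Set Coh := B.cls '' {D : B.LiftDatum | B.signature D = (a, b)}

/-- **BMM Corollary 7.3, AS PRINTED** (Acta Math. 216 (2016) p. 66 L11–L13; row I-t4-lit-2-1): «Let S be any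
connected component of S(K) and let a and b be integers such that 3(a+b)+|a−b| < 2m. Then H^{b×q,a×q}(S, ℂ) is
generated by classes of theta lifts from unitary groups of signature (a,b) at infinity.»  «Generated by» = the
ℂ-span of the classes is the whole piece. -/
def BMM2016_Cor7_3 : Prop :=
  ∀ a b : ℕ, B.Hyp a b → B.H b a = Submodule.span ℂ (B.liftClasses a b)

/-- **BMM Theorem 7.2, AS PRINTED** (p. 65 L48–L51; row I-t4-lit-2-2): «Let a and b be integers such that
3(a+b)+|a−b| < 2m and let π_f ∈ Coh_f^{b,a}. Set π = A(b×q,a×q) ⊗ π_f. Then π is in the image of the ψ-theta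
correspondence from a smaller group U(W) of signature (a,b) at infinity.» -/
def BMM2016_Thm7_2 : Prop :=
  ∀ a b : ℕ, B.Hyp a b → ∀ πf ∈ B.Cohf b a, B.InThetaImage b a πf (a, b)

/-- **The instance of (P)**: the complex 2-ball quotient, `(p, q) = (2, 1)`, `m = 3` — the anisotropic Hermitian
3-space of route/TIER3.md §1 item 3. -/
def IsBall : Prop := B.p = 2 ∧ B.q = 1

/-- **Corollary 7.3 at the 2-ball, degree one** — what the sentence (P) consumes: with `q = 1`, `m = 3`, the pairs
`(a, b) = (0, 1)` and `(1, 0)` satisfy `3·1 + 1 = 4 < 6`, so `H^{1,0}(S, ℂ) = H^{1×1,0×1}` is generated by classes of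
theta lifts from unitary groups of signature `(0, 1)` at infinity and `H^{0,1}(S, ℂ) = H^{0×1,1×1}` by those of
signature `(1, 0)` (footnote (1) p. 4: «b×q, a×q in order to write U(a,b)»). -/
def BMM2016_Cor7_3_ball : Prop :=
  B.H 1 0 = Submodule.span ℂ (B.liftClasses 0 1) ∧ B.H 0 1 = Submodule.span ℂ (B.liftClasses 1 0)

/-- `(0, 1)` satisfies BMM's hypothesis when `m = 3`. -/
theorem hyp_zero_one (hm : B.m = 3) : B.Hyp 0 1 := by
  unfold Hyp; rw [hm]; decide

/-- `(1, 0)` satisfies BMM's hypothesis when `m = 3`. -/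
theorem hyp_one_zero (hm : B.m = 3) : B.Hyp 1 0 := by
  unfold Hyp; rw [hm]; decide

/-- `(1, 1)` does NOT satisfy BMM's hypothesis when `m = 3` (`3·2 + 0 = 6 ≮ 6`): Corollary 7.3 says nothing
about `H^{1,1}` of the 2-ball (the print's own Remark p. 62 L2–L7). -/
theorem not_hyp_one_one (hm : B.m = 3) : ¬ B.Hyp 1 1 := by
  unfold Hyp; rw [hm]; decide

/-- **Composition (no published content)**: the ball instance of Corollary 7.3 is an instance of the printed
statement — `m = 3` is `m = p + q` at `(p, q) = (2, 1)`. -/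
theorem cor7_3_ball_of_cor7_3 (hB : B.IsBall) (h : B.BMM2016_Cor7_3) : B.BMM2016_Cor7_3_ball := by
  have hm : B.m = 3 := by rw [B.m_eq, hB.1, hB.2]
  exact ⟨h 0 1 (B.hyp_zero_one hm), h 1 0 (B.hyp_one_zero hm)⟩

/-- **Composition (no published content)**: under Corollary 7.3 at the ball, every holomorphic `1`-form class
lies in the span of the classes of theta lifts from `U(0,1)` at infinity. -/
theorem mem_span_liftClasses_of_mem_H10 (h : B.BMM2016_Cor7_3_ball) {x : Coh} (hx : x ∈ B.H 1 0) :
    x ∈ Submodule.span ℂ (B.liftClasses 0 1) := h.1 ▸ hx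

end BMMSetting

/-- **The special lifts of BMM §9.2 as an interface** (quotes in the module docstring): the cohomology
`CohSh = H^•(Sh(G), ℂ)` of the Shimura variety `Sh(G) = lim_K S(K)` with its refined pieces `H b a = H^{b×q,a×q}(Sh(G), ℂ)`
and the projections `proj b a` onto them; the lift data `(W, π′ ↔ f, χ, φ_∞ ⊗ φ_f)` of §7.3 / §9.2 with the signature of
`W` at infinity and the ARCHIMEDEAN Schwartz datum `archDatum D = φ_∞`; the distinguished archimedean data
`cocycle b a = ϕ_{bq,aq} ⊗ (Gaussians at the other infinite places)` (§9.2 p. 72 L31–L34); and the class `cls D` of the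
automorphic function `θ^f_{ψ,χ,φ}` of the datum.  Every field is a parameter. -/
structure BMMSpecialLiftSetting (CohSh : Type) [AddCommGroup CohSh] [Module ℂ CohSh] where
  /-- `m = dim_E V` -/
  m : ℕ
  /-- `H b a = H^{b×q,a×q}(Sh(G), ℂ)` -/
  H : ℕ → ℕ → Submodule ℂ CohSh
  /-- the projection of `H^•(Sh(G), ℂ)` onto `H^{b×q,a×q}(Sh(G), ℂ)` («the projections in H^{b×q,a×q}(Sh(G), ℂ)») -/
  proj : ℕ → ℕ → (CohSh →ₗ[ℂ] CohSh)
  /-- the projection lands in the piece -/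
  proj_mem : ∀ (b a : ℕ) (x : CohSh), proj b a x ∈ H b a
  /-- the lift data `(W, f, χ, φ_∞ ⊗ φ_f)` of §7.3 / §9.2 -/
  LiftDatum : Type
  /-- the signature `(a, b)` of `W` at infinity -/
  signature : LiftDatum → ℕ × ℕ
  /-- the archimedean Schwartz data `φ_∞ ∈ S(X(F_∞))` -/
  ArchDatum : Type
  /-- the archimedean component `φ_∞` of the datum («decomposable as φ_∞ ⊗ φ_f») -/
  archDatum : LiftDatum → ArchDatum
  /-- `cocycle b a` = «the Schwartz function in S(X(F_∞)) which is the tensor product of ϕ_{bq,aq} of §5, equation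
  (5.11), at the infinite place where the real group is non-compact and Gaussians at the other infinite places» -/
  cocycle : ℕ → ℕ → ArchDatum
  /-- the class in `H^•(Sh(G), ℂ)` of the automorphic function `θ^f_{ψ,χ,φ}` of the datum -/
  cls : LiftDatum → CohSh

namespace BMMSpecialLiftSetting

variable {CohSh : Type} [AddCommGroup CohSh] [Module ℂ CohSh] (B : BMMSpecialLiftSetting CohSh)

/-- BMM's numerical hypothesis `3(a+b) + |a−b| < 2m` (§9.1: «we will now always assume that a and b are integers such
that 3(a+b)+|a−b| < 2m»). -/
def Hyp (a b : ℕ) : Prop := 3 * (a + b) + ((a : ℤ) - b).natAbs < 2 * B.m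

/-- **`H^{b×q,a×q}(Sh(G), ℂ)_{special}`**: the span of the `H^{b×q,a×q}`-projections of the classes of the lifts from
`U(W)` of signature `(a, b)` whose archimedean datum is `ϕ_{bq,aq} ⊗ Gaussians` — «the subspace of special lifts that
are generated by the projections in H^{b×q,a×q}(Sh(G), ℂ) of the automorphic functions θ^f_{ψ,χ,ϕ_{bq,aq}⊗φ_f} as φ_f, χ
and f vary». -/
def special (a b : ℕ) : Submodule ℂ CohSh :=
  Submodule.span ℂ
    ((B.proj b a) '' (B.cls '' {D : B.LiftDatum | B.signature D = (a, b) ∧ B.archDatum D = B.cocycle b a}))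

/-- **BMM Theorem 9.1, AS PRINTED** (Acta Math. 216 (2016) p. 73 L2–L3, under the standing hypothesis of §9.1;
row I-t4-lit-2-20): «We have H^{b×q,a×q}(Sh(G), ℂ)_{special} = H^{b×q,a×q}(Sh(G), ℂ).» -/
def BMM2016_Thm9_1 : Prop :=
  ∀ a b : ℕ, B.Hyp a b → B.special a b = B.H b a

/-- **Theorem 9.1 at the 2-ball, degree one** (`m = 3`, `(b, a) = (1, 0)`): `H^{1,0}(Sh(G), ℂ)` is spanned by the
projections of the classes of the lifts `θ^f_{ψ,χ,ϕ_{1,0}⊗φ_f}` from `U(W)`, `W` of signature `(0, 1)` at infinity, with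
the holomorphic cocycle `ϕ_{1,0}` at the `(2,1)` place and Gaussians at the definite places. -/
def BMM2016_Thm9_1_ball : Prop := B.special 0 1 = B.H 1 0

/-- `(0, 1)` satisfies the §9.1 hypothesis when `m = 3`. -/
theorem hyp_zero_one (hm : B.m = 3) : B.Hyp 0 1 := by
  unfold Hyp; rw [hm]; decide

/-- **Composition (no published content)**: the ball instance of Theorem 9.1. -/
theorem thm9_1_ball_of_thm9_1 (hm : B.m = 3) (h : B.BMM2016_Thm9_1) : B.BMM2016_Thm9_1_ball :=
  h 0 1 (B.hyp_zero_one hm)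

/-- **Composition (no published content)**: under Theorem 9.1 at the ball, every class of `H^{1,0}(Sh(G), ℂ)` lies in
the span of the projected classes of special lifts with the named archimedean datum. -/
theorem mem_special_of_mem_H10 (h : B.BMM2016_Thm9_1_ball) {x : CohSh} (hx : x ∈ B.H 1 0) :
    x ∈ B.special 0 1 := h ▸ hx

end BMMSpecialLiftSetting

/-- **The Vogan–Zuckerman highest weight of `V(b×q, a×q)` as printed** (`K_ℂ = GL(p) × GL(q)`, `(p entries; q entries)`):
`(q, …, q [b], 0, …, 0 [p−a−b], −q, …, −q [a]; a−b, …, a−b [q])` (BMM p. 24 L19–L27; for `a = 0` this is Lemma 3.7's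
Remark, for `b = 0` Lemma 3.9's Remark). -/
def vzWeight (p q a b : ℕ) : List ℤ × List ℤ :=
  (List.replicate b (q : ℤ) ++ List.replicate (p - a - b) 0 ++ List.replicate a (-(q : ℤ)),
   List.replicate q ((a : ℤ) - b))

/-- **The cohomological representations of `U(p,q)` and their lowest K-types as an interface** (§3.2 / §3.8): the types `Rep`
of unitary representations of `G = U(p,q)` and `KType` of irreducible representations of `K = U(p) × U(q)`, the highest
weight `hw` of a K-type (`p` entries; `q` entries, `K_ℂ = GL(p) × GL(q)`), the representations `A b a = A(b×q, a×q)`, the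
K-types `V b a = V(b×q, a×q)`, and `occursIn τ π` = «Hom_K(τ, π) ≠ 0».  Every field is a parameter. -/
structure BMMKTypeSetting where
  /-- the signature `(p, q)` of `V_{τ_1}` -/
  p : ℕ
  q : ℕ
  /-- unitary representations of `U(p,q)` -/
  Rep : Type
  /-- irreducible representations of `K = U(p) × U(q)` -/
  KType : Type
  /-- the highest weight of a K-type: `p` entries on `GL(p)`, `q` entries on `GL(q)` -/
  hw : KType → List ℤ × List ℤ
  /-- `A b a = A(b×q, a×q)`, the cohomological representation of §3.13 / §3.11 / §3.12 -/
  A : ℕ → ℕ → Rep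
  /-- `V b a = V(b×q, a×q)`, the Vogan–Zuckerman K-type generated by `e(bq, aq)` -/
  V : ℕ → ℕ → KType
  /-- `occursIn τ π` = «Hom_K(τ, π) ≠ 0» -/
  occursIn : KType → Rep → Prop

namespace BMMKTypeSetting

variable (B : BMMKTypeSetting)

/-- **BMM §3.2 (2), AS PRINTED** for the parabolics `Q_{b,a}`: «Hom_K(V(q), A_q) ≠ 0» — the Vogan–Zuckerman K-type occurs
in its cohomological representation (p. 14 L25). -/
def BMM2016_Sec3_2_occurs : Prop := ∀ b a : ℕ, B.occursIn (B.V b a) (B.A b a)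

/-- **BMM Lemma 3.7 + Remark, AS PRINTED** (p. 22 L2–L15): `V(b×q) = V(b×q, 0)` «has highest weight
(q, …, q [b], 0, …, 0 [p−b]; −b, …, −b [q])» (for `b ≤ p`). -/
def BMM2016_Lemma3_7 : Prop := ∀ b : ℕ, b ≤ B.p → B.hw (B.V b 0) = vzWeight B.p B.q 0 b

/-- **BMM Lemma 3.9 + Remark, AS PRINTED** (p. 23 L4–L18): `V(0, a×q)` «has highest weight
(0, …, 0 [p−a], −q, …, −q [a]; a, …, a [q])» (for `a ≤ p`). -/
def BMM2016_Lemma3_9 : Prop := ∀ a : ℕ, a ≤ B.p → B.hw (B.V 0 a) = vzWeight B.p B.q a 0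

/-- **BMM Lemma 3.11 with the weight display, AS PRINTED** (p. 23 L22–L23 «a and b are positive integers satisfying
a + b ⩽ p»; p. 24 L19–L33): `V(b×q, a×q)` has highest weight «(q, …, q [b], 0, …, 0, −q, …, −q [a]; a−b, …, a−b [q])». -/
def BMM2016_Lemma3_11 : Prop :=
  ∀ a b : ℕ, 0 < a → 0 < b → a + b ≤ B.p → B.hw (B.V b a) = vzWeight B.p B.q a b

/-- **The instance of (P)**: `U(2,1)`. -/
def IsU21 : Prop := B.p = 2 ∧ B.q = 1

/-- `vzWeight 2 1 1 1 = ([1, -1], [0])`: the lowest K-type of the `(1,1)`-cohomological representation of `U(2,1)`. -/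
theorem vzWeight_two_one_one_one : vzWeight 2 1 1 1 = ([1, -1], [0]) := by decide

/-- `vzWeight 2 1 0 1 = ([1, 0], [-1])`: the lowest K-type of `A(1×1, 0)` (the `(1,0)`-type) of `U(2,1)`. -/
theorem vzWeight_two_one_zero_one : vzWeight 2 1 0 1 = ([1, 0], [-1]) := by decide

/-- `vzWeight 2 1 1 0 = ([0, -1], [1])`: the lowest K-type of `A(0, 1×1)` (the `(0,1)`-type) of `U(2,1)`. -/
theorem vzWeight_two_one_one_zero : vzWeight 2 1 1 0 = ([0, -1], [1]) := by decide

/-- **Composition (no published content)**: at `U(2,1)`, Lemma 3.11 gives the highest weight `(1, −1; 0)` of `V(1×1, 1×1)`. -/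
theorem hw_V11_of_lemma3_11 (hB : B.IsU21) (h : B.BMM2016_Lemma3_11) : B.hw (B.V 1 1) = ([1, -1], [0]) := by
  have := h 1 1 Nat.one_pos Nat.one_pos (by rw [hB.1])
  rw [this, hB.1, hB.2]; decide

/-- **Composition (no published content)**: at `U(2,1)`, Lemma 3.7 gives the highest weight `(1, 0; −1)` of `V(1×1, 0)`. -/
theorem hw_V10_of_lemma3_7 (hB : B.IsU21) (h : B.BMM2016_Lemma3_7) : B.hw (B.V 1 0) = ([1, 0], [-1]) := by
  have := h 1 (by rw [hB.1]; decide)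
  rw [this, hB.1, hB.2]; decide

end BMMKTypeSetting

/-- **The §7.2 twist Remark as an interface**: the pairs of splitting characters `χ = (χ_1, χ_2)` of `𝔸_E^×/E^×`
with `χ_1|_{𝔸^×} = ε^m_{E/F}`, `χ_2|_{𝔸^×} = ε^n_{E/F}` (§7.2 p. 63 L13–L17), the points `g ∈ U_m(𝔸)`,
`g′ ∈ U_n(𝔸)`, the Weil representation `ω_ψ(ĩ_χ(g,g′))` on the Schwartz space `S(X(𝔸))` (7.1) — the ℂ-module parameter `Schwartz`, and — for two
pairs `χ, χ′` — the characters `ν_m = ν′∘det` of `U_m(𝔸)` and `µ_n = µ′∘det` of `U_n(𝔸)` defined from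
`µ = χ′_1 χ_1^{−1}`, `ν = χ′_2 χ_2^{−1}` by `µ′(x/x̄) = µ(x)`, `ν′(x/x̄) = ν(x)`.  Every field is a parameter. -/
structure BMMTwistSetting (Schwartz : Type) [AddCommGroup Schwartz] [Module ℂ Schwartz] where
  /-- the admissible pairs of splitting characters `(χ_1, χ_2)` -/
  SplitChars : Type
  /-- the adelic points of `U(V)`, `m = dim V` -/
  Gm : Type
  /-- the adelic points of `U(W)`, `n = dim W` -/
  Gn : Type
  /-- `ω_ψ(ĩ_χ(g, g′))` acting on `S(X(𝔸))` -/
  weil : SplitChars → Gm → Gn → (Schwartz →ₗ[ℂ] Schwartz)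
  /-- `ν_m(g) = ν′(det g)` for the pair `(χ, χ′)`, `ν = χ′_2 χ_2^{−1}` -/
  nu_m : SplitChars → SplitChars → Gm → ℂ
  /-- `µ_n(g′) = µ′(det g′)` for the pair `(χ, χ′)`, `µ = χ′_1 χ_1^{−1}` -/
  mu_n : SplitChars → SplitChars → Gn → ℂ

/-- **BMM §7.2 Remark, AS PRINTED** (p. 63 L33–p. 64 L4; row I-t4-lit-2-5): for two admissible pairs `χ, χ′`,
«ω_ψ(ĩ_{χ′}(g,g′)) = ω_ψ(ĩ_χ(g,g′)) ν_m(g) µ_n(g′)».  (The route's «χ_W, the one splitting character of the plane»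
enters the lift of a line character through exactly this twist.) -/
def BMM2016_Sec7_2_twist {Schwartz : Type} [AddCommGroup Schwartz] [Module ℂ Schwartz]
    (T : BMMTwistSetting Schwartz) : Prop :=
  ∀ (χ χ' : T.SplitChars) (g : T.Gm) (g' : T.Gn),
    T.weil χ' g g' = (T.nu_m χ χ' g * T.mu_n χ χ' g') • T.weil χ g g'

end Summit.Ventures.HodgeRepro.Tier4.Lit

end
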